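import Summits.Ventures.CertifiedManyBodySolver.Observables.RungLeavesCoverageNdNiO2ResidualDensityBundlesHigh
import HarnessLib

/-!
# Ventures/CertifiedManyBodySolver — Observables/RungLeavesCoverageNdNiO2ResidualDensityBundlesCaps.lean

HONEST FRAMING: one-sided certified CEILINGS on the uniform flux stiffness on the DOWNFOLDED d⁹-nickelate box of record `boxNdNiO2E_M21` (NdNiO₂ parent
film; router/BOXES/NdNiO2.md «1BH+3BE», SCREENING-GRADE) — wording class (xx1): CONTROL / CALIBRATION + labelled heuristic; a ceiling never speaks to the
presence of superconductivity; never «certified true negative / positive»; not a `T_c` or phase-diagram statement; no summit statement is proved here.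
CONDITIONAL closers only: every conclusion is conditional BY NAME on the bundle rows and cap tables it names; floors node-free; no number of record is
asserted; no `sorry`; no definition; zero compute.

Cells `pub/hubbard-obs` ∧ `pub/hubbard-downfold` (MO-S2 ∧ MO-S1, D-0154 (1)(C) COVERAGE material (iii) NdNiO₂), seat `hubbard-cov-ndnio2-unc-3`
(`prover-hubbard-cov-ndnio2-unc-3-g2-0`; lane = the DENSITY direction; write_cruxes stmt-Ventures-26751 `ResidualLowUSlab` / stmt-Ventures-26752
`ResidualHighUSlab` of route-Ventures-CovNdNiO2M21 — SUPPORT, no claim). Third part of `Observables/RungLeavesCoverageNdNiO2ResidualDensityBundles{,High}.lean`.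
THE POINT. The W1-plugged closers of part 2 fix the cap key (hubbard-fast-bands-1 `ndM21res_capW1_segA/B/C`, CONDITIONAL on #396 ∧ `hVLc`). Two more cap
families now exist or are announced in the SAME binder shape `∀ U s n, 0 ≤ U → U ≤ U_A → a ≤ s → s ≤ b → n₁ ≤ n → n ≤ 477/500 → e₀(1,s,U,n) ≤ C`:
hubbard-cov-ndnio2-unc-1 g3's NODE-FREE station chord caps (`Certificates/HubbardSquare_NdBoxE_stations_afChordCaps.lean`, p628541:
`ndBoxE_station5_afChordCap_segA` `−0.7164236581`, `…_segBC` `−0.7077584984`; station-6 part 2 announced) and any STEP-2 re-key of W1. So this file states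
the closers ONCE over cap TABLES of that shape (free endpoints `a ≤` used left end, `b ≥` used right end, `n₁ ≤ 183/200`, any real constant `C`):

* §8 `ndM21_residualLowUSlab_of_bundleRowsWN_capTables` / `ndM21_residualHighUSlab_of_bundleRowsWN_capTables` (station `U_A = 5`): bundle rows + three
  (two) cap tables + thresholds `lo ≤` rectangle band-bottom constant, `C ≤ hi` + end prices ⇒ the crux statements; instantiate the tables with
  `ndM21res_capW1_segX h396 hVLc` (edition of record) or with unc-1's `ndBoxE_station5_afChordCap_segA/segBC` (a bundle keyed at the node-free cap closes with
  NO cap node at all) — the side conditions are `norm_num` facts;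
* §9 the STATION-6 reserve edition E-R′ of the HIGH slab (captain D9 (6) / D9′: parents «ndnio2-gen-D» at `(6, 477/500)`, `t′ ∈ {−253/425, −11/20, −23/50, −11/25}`):
  `ndM21_residualHighUSlab_of_station6_bundleRowsWN_capTables` — four bundle rows at `U_A = 6` (objective `U`-slot arbitrary, `oddMomentObsTT_lam_zero`) on
  A6 `⊇ [−253/425, −11/20]`, B6 `⊇ [−11/20, −154/325]` (sources of `U ∈ [13/2, 17/2]` from station 6: `[p(2 − 12/17), q(2 − 12/13)]`), two station-6 cap tables
  (`U ≤ 6`), thresholds (`lo ≤ −120681/53125` on A6 = this seat's `ndBoxE_floorRow_tpm253o425_n477o500` literal, `lo ≤ −5247/2500` on B6), 12 end prices ⇒ the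
  statement of `ResidualHighUSlab` (box-2's `…_on_highSlab_…` with `U_A = 6`, `U₁ = 13/2`, `U_max = 17/2`).

NOT said: that any bundle certificate exists; which edition the captain picks; a number of record; anything toward smaller `U`.

References: S. Boyd, L. Vandenberghe, *Convex Optimization* (2004) §5.9 [BoydVandenberghe2004]; T. Koma, H. Tasaki, J. Stat. Phys. 76 (1994) 745, §1
[KomaTasaki1994]; D. J. Scalapino, S. R. White, S.-C. Zhang, PRB 47 (1993) 7995, §II [ScalapinoWhiteZhang1993]; E. H. Lieb, M. Loss, Duke Math. J. 71 (1993)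
337, §8 Thm 8.2 [LiebLoss1993]; T. Hazra, N. Verma, M. Randeria, PRX 9 (2019) 031049, eq. (4) [HazraVermaRanderia2019].
-/

noncomputable section

namespace Summit.Ventures.CertifiedManyBodySolver.Observables

open Set Filter Topology
open Summit.Ventures.CertifiedManyBodySolver.Downfold
open Summit.Ventures.CertifiedManyBodySolver.Certificates
open Literature.MathematicalPhysics.QuantumLattice Literature.MathematicalPhysics.QuantumLattice.ThermodynamicLimit
open Literature.Probability.LatticeModels
open Matrix HubbardWave0
open scoped BigOperators ComplexOrder

/-! ## §8 Station `U_A = 5`: the closers over cap TABLES in the producers' binder shape -/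

section Station5CapTables

/-- **Window from a cap TABLE in binder shape** (`∀ U s n, 0 ≤ U → U ≤ U_A → a ≤ s → s ≤ b → n₁ ≤ n → n ≤ 477/500 → e₀ ≤ C`) read at the station `U = U_A ≥ 0`
on a sub-rectangle `[a', b'] × R‴` (`a ≤ a'`, `b' ≤ b`, `n₁ ≤ 183/200`), plus a node-free floor table `fl ≤ e₀` there and thresholds `lo ≤ fl`, `C ≤ hi` ⇒ the bundle
window `lo ≤ e₀(1, s, U_A, x) ≤ hi` on the sub-rectangle. [folklore] -/
theorem bundleWindow_of_capTable {UA a b a' b' n₁ C : ℝ} {lo hi fl : ℚ} (hUA : 0 ≤ UA)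
    (hcap : ∀ U s n : ℝ, 0 ≤ U → U ≤ UA → a ≤ s → s ≤ b → n₁ ≤ n → n ≤ 477 / 500 → energyDensityTT' 1 s U n ≤ C)
    (ha : a ≤ a') (hb : b' ≤ b) (hn₁ : n₁ ≤ 183 / 200)
    (hfl : ∀ s ∈ Set.Icc a' b', ∀ x ∈ Set.Icc (183 / 200 : ℝ) (477 / 500), ((fl : ℚ) : ℝ) ≤ energyDensityTT' 1 s UA x)
    (hlo : lo ≤ fl) (hhi : C ≤ ((hi : ℚ) : ℝ)) :
    ∀ s ∈ Set.Icc a' b', ∀ x ∈ Set.Icc (183 / 200 : ℝ) (477 / 500),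
      ((lo : ℚ) : ℝ) ≤ energyDensityTT' 1 s UA x ∧ energyDensityTT' 1 s UA x ≤ ((hi : ℚ) : ℝ) :=
  fun s hs x hx =>
    ⟨(Rat.cast_le.2 hlo).trans (hfl s hs x hx),
      (hcap UA s x hUA le_rfl (ha.trans hs.1) (hs.2.trans hb) (hn₁.trans hx.1) hx.2).trans hhi⟩

/-- **`ResidualLowUSlab` over cap TABLES (station 5).** Six bundle rows as in `ndM21_residualLowUSlab_of_bundleRowsWN`; three cap tables in binder shape on segments
`[aA, bA] ⊇ [−184/325, −11/20]`, `[aB, bB] ⊇ [−11/20, −23/50]`, `[aC, bC] ⊇ [−23/50, −11/25]` (valid up to `U ≤ 5`, from fillings `nX ≤ 183/200`); thresholds `lo ≤ −87768/40625 |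
−5247/2500 | −6678/3125`, `CX ≤ hi`; 18 end prices; `c ≤ 4779578/10⁷` ⇒ the statement of `Theses.CovNdNiO2M21.ResidualLowUSlab`. Tables: `ndM21res_capW1_segA/B/C h396 hVLc`
(W1, of record) or `ndBoxE_station5_afChordCap_segA` / `…_segBC` (node-free, unc-1 g3). [cite: KomaTasaki1994, §1] [cite: ScalapinoWhiteZhang1993, §II] -/
theorem ndM21_residualLowUSlab_of_bundleRowsWN_capTables {sA₁ sA₂ sB₁ sB₂ sC₁ sC₂ aA bA nA CA aB bB nB CB aC bC nC CC : ℝ}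
    {loPA hiPA FPA sPA₁ sPA₂ loQA hiQA FQA sQA₁ sQA₂ loPB hiPB FPB sPB₁ sPB₂ loQB hiQB FQB sQB₁ sQB₂
      loPC hiPC FPC sPC₁ sPC₂ loQC hiQC FQC sQC₁ sQC₂ c : ℚ}
    (hPA : TPrimeBundleOrbitLowerRowWN 5 sA₁ sA₂ loPA hiPA FPA sPA₁ sPA₂ (477 / 500) (fun _ => -oddMomentObsTT (-23 / 50) 5 0))
    (hQA : TPrimeBundleOrbitLowerRowWN 5 sA₁ sA₂ loQA hiQA FQA sQA₁ sQA₂ (477 / 500) (fun _ => -oddMomentObsTT (-11 / 25) 5 0))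
    (hPB : TPrimeBundleOrbitLowerRowWN 5 sB₁ sB₂ loPB hiPB FPB sPB₁ sPB₂ (477 / 500) (fun _ => -oddMomentObsTT (-23 / 50) 5 0))
    (hQB : TPrimeBundleOrbitLowerRowWN 5 sB₁ sB₂ loQB hiQB FQB sQB₁ sQB₂ (477 / 500) (fun _ => -oddMomentObsTT (-11 / 25) 5 0))
    (hPC : TPrimeBundleOrbitLowerRowWN 5 sC₁ sC₂ loPC hiPC FPC sPC₁ sPC₂ (477 / 500) (fun _ => -oddMomentObsTT (-23 / 50) 5 0))
    (hQC : TPrimeBundleOrbitLowerRowWN 5 sC₁ sC₂ loQC hiQC FQC sQC₁ sQC₂ (477 / 500) (fun _ => -oddMomentObsTT (-11 / 25) 5 0))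
    (hA₁ : sA₁ ≤ -(184 / 325)) (hA₂ : (-11 / 20 : ℝ) ≤ sA₂) (hB₁ : sB₁ ≤ -11 / 20) (hB₂ : (-23 / 50 : ℝ) ≤ sB₂)
    (hC₁ : sC₁ ≤ -23 / 50) (hC₂ : (-11 / 25 : ℝ) ≤ sC₂)
    (hcapA : ∀ U s n : ℝ, 0 ≤ U → U ≤ 5 → aA ≤ s → s ≤ bA → nA ≤ n → n ≤ 477 / 500 → energyDensityTT' 1 s U n ≤ CA)
    (hcapB : ∀ U s n : ℝ, 0 ≤ U → U ≤ 5 → aB ≤ s → s ≤ bB → nB ≤ n → n ≤ 477 / 500 → energyDensityTT' 1 s U n ≤ CB)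
    (hcapC : ∀ U s n : ℝ, 0 ≤ U → U ≤ 5 → aC ≤ s → s ≤ bC → nC ≤ n → n ≤ 477 / 500 → energyDensityTT' 1 s U n ≤ CC)
    (haA : aA ≤ -(184 / 325)) (hbA : (-11 / 20 : ℝ) ≤ bA) (hnA : nA ≤ 183 / 200)
    (haB : aB ≤ -11 / 20) (hbB : (-23 / 50 : ℝ) ≤ bB) (hnB : nB ≤ 183 / 200)
    (haC : aC ≤ -23 / 50) (hbC : (-11 / 25 : ℝ) ≤ bC) (hnC : nC ≤ 183 / 200)
    (hloPA : loPA ≤ -87768 / 40625) (hloQA : loQA ≤ -87768 / 40625) (hloPB : loPB ≤ -5247 / 2500) (hloQB : loQB ≤ -5247 / 2500)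
    (hloPC : loPC ≤ -6678 / 3125) (hloQC : loQC ≤ -6678 / 3125)
    (hhiPA : CA ≤ ((hiPA : ℚ) : ℝ)) (hhiQA : CA ≤ ((hiQA : ℚ) : ℝ)) (hhiPB : CB ≤ ((hiPB : ℚ) : ℝ)) (hhiQB : CB ≤ ((hiQB : ℚ) : ℝ))
    (hhiPC : CC ≤ ((hiPC : ℚ) : ℝ)) (hhiQC : CC ≤ ((hiQC : ℚ) : ℝ))
    (pPA : -FPA - sPA₁ * (183 / 200 - 477 / 500) ≤ c ∧ -FPA - sPA₂ * (183 / 200 - 477 / 500) ≤ c ∧ -FPA ≤ c)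
    (pQA : -FQA - sQA₁ * (183 / 200 - 477 / 500) ≤ c ∧ -FQA - sQA₂ * (183 / 200 - 477 / 500) ≤ c ∧ -FQA ≤ c)
    (pPB : -FPB - sPB₁ * (183 / 200 - 477 / 500) ≤ c ∧ -FPB - sPB₂ * (183 / 200 - 477 / 500) ≤ c ∧ -FPB ≤ c)
    (pQB : -FQB - sQB₁ * (183 / 200 - 477 / 500) ≤ c ∧ -FQB - sQB₂ * (183 / 200 - 477 / 500) ≤ c ∧ -FQB ≤ c)
    (pPC : -FPC - sPC₁ * (183 / 200 - 477 / 500) ≤ c ∧ -FPC - sPC₂ * (183 / 200 - 477 / 500) ≤ c ∧ -FPC ≤ c)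
    (pQC : -FQC - sQC₁ * (183 / 200 - 477 / 500) ≤ c ∧ -FQC - sQC₂ * (183 / 200 - 477 / 500) ≤ c ∧ -FQC ≤ c)
    (hc : c ≤ 4779578 / 10000000) :
    ∀ tp ∈ Set.Icc (-23 / 50 : ℝ) (-11 / 25), ∀ U ∈ Set.Icc (5 : ℝ) (13 / 2), ∀ n ∈ Set.Icc (9 / 10 : ℝ) (477 / 500),
      ObsStiffnessSeqCeilingAt tp U n (4779578 / 10000000) := by
  have h5 : (0 : ℝ) ≤ 5 := by norm_num
  obtain ⟨flA, -⟩ := ndM21_station5_rectFloors_short (U := (5 : ℝ)) h5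
  obtain ⟨-, flB, flC⟩ := ndM21_station5_rectFloors (U := (5 : ℝ)) h5
  exact ndM21_residualLowUSlab_of_bundleRowsWN hPA hQA hPB hQB hPC hQC hA₁ hA₂ hB₁ hB₂ hC₁ hC₂
    (bundleWindow_of_capTable h5 hcapA haA hbA hnA flA hloPA hhiPA) (bundleWindow_of_capTable h5 hcapA haA hbA hnA flA hloQA hhiQA)
    (bundleWindow_of_capTable h5 hcapB haB hbB hnB flB hloPB hhiPB) (bundleWindow_of_capTable h5 hcapB haB hbB hnB flB hloQB hhiQB)
    (bundleWindow_of_capTable h5 hcapC haC hbC hnC flC hloPC hhiPC) (bundleWindow_of_capTable h5 hcapC haC hbC hnC flC hloQC hhiQC)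
    pPA pQA pPB pQB pPC pQC hc

/-- **`ResidualHighUSlab` over cap TABLES (station 5, edition E-R of record).** Four bundle rows as in `ndM21_residualHighUSlab_of_bundleRowsWN`; two cap tables on
`[aA, bA] ⊇ [−276/425, −11/20]`, `[aB, bB] ⊇ [−11/20, −176/325]`; thresholds `lo ≤ −131652/53125 | −5247/2500`, `CX ≤ hi`; 12 end prices; `c ≤ 4779578/10⁷` ⇒ the statement
of `Theses.CovNdNiO2M21.ResidualHighUSlab`. [cite: KomaTasaki1994, §1] [cite: ScalapinoWhiteZhang1993, §II] -/
theorem ndM21_residualHighUSlab_of_bundleRowsWN_capTables {sA₁ sA₂ sB₁ sB₂ aA bA nA CA aB bB nB CB : ℝ}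
    {loPA hiPA FPA sPA₁ sPA₂ loQA hiQA FQA sQA₁ sQA₂ loPB hiPB FPB sPB₁ sPB₂ loQB hiQB FQB sQB₁ sQB₂ c : ℚ}
    (hPA : TPrimeBundleOrbitLowerRowWN 5 sA₁ sA₂ loPA hiPA FPA sPA₁ sPA₂ (477 / 500) (fun _ => -oddMomentObsTT (-23 / 50) 5 0))
    (hQA : TPrimeBundleOrbitLowerRowWN 5 sA₁ sA₂ loQA hiQA FQA sQA₁ sQA₂ (477 / 500) (fun _ => -oddMomentObsTT (-11 / 25) 5 0))
    (hPB : TPrimeBundleOrbitLowerRowWN 5 sB₁ sB₂ loPB hiPB FPB sPB₁ sPB₂ (477 / 500) (fun _ => -oddMomentObsTT (-23 / 50) 5 0))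
    (hQB : TPrimeBundleOrbitLowerRowWN 5 sB₁ sB₂ loQB hiQB FQB sQB₁ sQB₂ (477 / 500) (fun _ => -oddMomentObsTT (-11 / 25) 5 0))
    (hA₁ : sA₁ ≤ -(276 / 425)) (hA₂ : (-11 / 20 : ℝ) ≤ sA₂) (hB₁ : sB₁ ≤ -11 / 20) (hB₂ : (-(176 / 325) : ℝ) ≤ sB₂)
    (hcapA : ∀ U s n : ℝ, 0 ≤ U → U ≤ 5 → aA ≤ s → s ≤ bA → nA ≤ n → n ≤ 477 / 500 → energyDensityTT' 1 s U n ≤ CA)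
    (hcapB : ∀ U s n : ℝ, 0 ≤ U → U ≤ 5 → aB ≤ s → s ≤ bB → nB ≤ n → n ≤ 477 / 500 → energyDensityTT' 1 s U n ≤ CB)
    (haA : aA ≤ -(276 / 425)) (hbA : (-11 / 20 : ℝ) ≤ bA) (hnA : nA ≤ 183 / 200)
    (haB : aB ≤ -11 / 20) (hbB : (-(176 / 325) : ℝ) ≤ bB) (hnB : nB ≤ 183 / 200)
    (hloPA : loPA ≤ -131652 / 53125) (hloQA : loQA ≤ -131652 / 53125) (hloPB : loPB ≤ -5247 / 2500) (hloQB : loQB ≤ -5247 / 2500)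
    (hhiPA : CA ≤ ((hiPA : ℚ) : ℝ)) (hhiQA : CA ≤ ((hiQA : ℚ) : ℝ)) (hhiPB : CB ≤ ((hiPB : ℚ) : ℝ)) (hhiQB : CB ≤ ((hiQB : ℚ) : ℝ))
    (pPA : -FPA - sPA₁ * (183 / 200 - 477 / 500) ≤ c ∧ -FPA - sPA₂ * (183 / 200 - 477 / 500) ≤ c ∧ -FPA ≤ c)
    (pQA : -FQA - sQA₁ * (183 / 200 - 477 / 500) ≤ c ∧ -FQA - sQA₂ * (183 / 200 - 477 / 500) ≤ c ∧ -FQA ≤ c)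
    (pPB : -FPB - sPB₁ * (183 / 200 - 477 / 500) ≤ c ∧ -FPB - sPB₂ * (183 / 200 - 477 / 500) ≤ c ∧ -FPB ≤ c)
    (pQB : -FQB - sQB₁ * (183 / 200 - 477 / 500) ≤ c ∧ -FQB - sQB₂ * (183 / 200 - 477 / 500) ≤ c ∧ -FQB ≤ c)
    (hc : c ≤ 4779578 / 10000000) :
    ∀ tp ∈ Set.Icc (-23 / 50 : ℝ) (-11 / 25), ∀ U ∈ Set.Icc (13 / 2 : ℝ) (17 / 2), ∀ n ∈ Set.Icc (9 / 10 : ℝ) (477 / 500),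
      ObsStiffnessSeqCeilingAt tp U n (4779578 / 10000000) := by
  have h5 : (0 : ℝ) ≤ 5 := by norm_num
  obtain ⟨-, flB⟩ := ndM21_station5_rectFloors_short (U := (5 : ℝ)) h5
  obtain ⟨flA, -, -⟩ := ndM21_station5_rectFloors (U := (5 : ℝ)) h5
  exact ndM21_residualHighUSlab_of_bundleRowsWN hPA hQA hPB hQB hA₁ hA₂ hB₁ hB₂
    (bundleWindow_of_capTable h5 hcapA haA hbA hnA flA hloPA hhiPA) (bundleWindow_of_capTable h5 hcapA haA hbA hnA flA hloQA hhiQA)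
    (bundleWindow_of_capTable h5 hcapB haB hbB hnB flB hloPB hhiPB) (bundleWindow_of_capTable h5 hcapB haB hbB hnB flB hloQB hhiQB)
    pPA pQA pPB pQB hc

end Station5CapTables

/-! ## §9 Station `U_A = 6`: the reserve edition E-R′ of the HIGH slab (sources `[−253/425, −154/325]`) -/

section Station6

/-- The station-6 segment ends: `(−23/50)(2 − 6/(17/2)) = −253/425` and `(−11/25)(2 − 6/(13/2)) = −154/325`. [folklore] -/
theorem ndM21_station6_highSlab_segment_ends :
    (-23 / 50 : ℝ) * (2 - (6 : ℝ) / (17 / 2 : ℝ)) = -(253 / 425) ∧ (-11 / 25 : ℝ) * (2 - (6 : ℝ) / (13 / 2 : ℝ)) = -(154 / 325) := by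
  constructor <;> norm_num

/-- **Rectangle FLOORS at any `U ≥ 0` on the station-6 sub-segments × R‴** (node-free): `[−253/425, −11/20]`: `−120681/53125 ≤ e₀` (`= 4·(−253/425)·477/500`, this seat's
`ndBoxE_floorRow_tpm253o425_n477o500` literal); `[−11/20, −154/325]`: `−5247/2500 ≤ e₀`. [cite: LiebLoss1993, §8, Theorem 8.2] -/
theorem ndM21_station6_rectFloors {U : ℝ} (hU : 0 ≤ U) :
    (∀ s ∈ Set.Icc (-(253 / 425) : ℝ) (-11 / 20), ∀ x ∈ Set.Icc (183 / 200 : ℝ) (477 / 500),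
        (((-120681 / 53125 : ℚ)) : ℝ) ≤ energyDensityTT' 1 s U x) ∧
      (∀ s ∈ Set.Icc (-11 / 20 : ℝ) (-(154 / 325)), ∀ x ∈ Set.Icc (183 / 200 : ℝ) (477 / 500),
        (((-5247 / 2500 : ℚ)) : ℝ) ≤ energyDensityTT' 1 s U x) := by
  refine ⟨fun s hs x hx => le_trans ?_ (bandBottomFloor_on_rect hU (by norm_num) (by norm_num) s hs x hx),
    fun s hs x hx => le_trans ?_ (bandBottomFloor_on_rect hU (by norm_num) (by norm_num) s hs x hx)⟩
  · rw [min_eq_left (by norm_num)]; norm_num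
  · rw [min_eq_left (by norm_num)]; norm_num

/-- **`ResidualHighUSlab` FROM STATION 6 (reserve edition E-R′), over cap TABLES.** Four bundle rows at `U_A = 6`, anchor `477/500`, objectives `−X₀(−23/50, U_o)`,
`−X₀(−11/25, U_o)` with ANY `U`-slot label `U_o` (idle at `λ = 0`, `oddMomentObsTT_lam_zero`), on A6 `[sA₁, sA₂] ⊇ [−253/425, −11/20]` and B6 `⊇ [−11/20, −154/325]`;
two station-6 cap tables in binder shape (`U ≤ 6`; e.g. unc-1 g3's station-6 chord caps, or captain D9 (3)'s cap law typed as a theorem); thresholds `lo ≤ −120681/53125 |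
−5247/2500`, `CX ≤ hi`; 12 end prices; `c ≤ 4779578/10⁷` ⇒ the statement of `Theses.CovNdNiO2M21.ResidualHighUSlab` (box-2's `…_on_highSlab_…` with `U_A = 6`,
`U₁ = 13/2`, `U_max = 17/2`; strip `n ≤ 183/200` by `ndnio2_M21_lowFillingCell183_below_bar`). CONDITIONAL on the rows and tables; no number asserted.
[cite: KomaTasaki1994, §1] [cite: ScalapinoWhiteZhang1993, §II] [cite: HazraVermaRanderia2019, eq. (4)] -/
theorem ndM21_residualHighUSlab_of_station6_bundleRowsWN_capTables (Uo : ℝ) {sA₁ sA₂ sB₁ sB₂ aA bA nA CA aB bB nB CB : ℝ}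
    {loPA hiPA FPA sPA₁ sPA₂ loQA hiQA FQA sQA₁ sQA₂ loPB hiPB FPB sPB₁ sPB₂ loQB hiQB FQB sQB₁ sQB₂ c : ℚ}
    (hPA : TPrimeBundleOrbitLowerRowWN 6 sA₁ sA₂ loPA hiPA FPA sPA₁ sPA₂ (477 / 500) (fun _ => -oddMomentObsTT (-23 / 50) Uo 0))
    (hQA : TPrimeBundleOrbitLowerRowWN 6 sA₁ sA₂ loQA hiQA FQA sQA₁ sQA₂ (477 / 500) (fun _ => -oddMomentObsTT (-11 / 25) Uo 0))
    (hPB : TPrimeBundleOrbitLowerRowWN 6 sB₁ sB₂ loPB hiPB FPB sPB₁ sPB₂ (477 / 500) (fun _ => -oddMomentObsTT (-23 / 50) Uo 0))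
    (hQB : TPrimeBundleOrbitLowerRowWN 6 sB₁ sB₂ loQB hiQB FQB sQB₁ sQB₂ (477 / 500) (fun _ => -oddMomentObsTT (-11 / 25) Uo 0))
    (hA₁ : sA₁ ≤ -(253 / 425)) (hA₂ : (-11 / 20 : ℝ) ≤ sA₂) (hB₁ : sB₁ ≤ -11 / 20) (hB₂ : (-(154 / 325) : ℝ) ≤ sB₂)
    (hcapA : ∀ U s n : ℝ, 0 ≤ U → U ≤ 6 → aA ≤ s → s ≤ bA → nA ≤ n → n ≤ 477 / 500 → energyDensityTT' 1 s U n ≤ CA)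
    (hcapB : ∀ U s n : ℝ, 0 ≤ U → U ≤ 6 → aB ≤ s → s ≤ bB → nB ≤ n → n ≤ 477 / 500 → energyDensityTT' 1 s U n ≤ CB)
    (haA : aA ≤ -(253 / 425)) (hbA : (-11 / 20 : ℝ) ≤ bA) (hnA : nA ≤ 183 / 200)
    (haB : aB ≤ -11 / 20) (hbB : (-(154 / 325) : ℝ) ≤ bB) (hnB : nB ≤ 183 / 200)
    (hloPA : loPA ≤ -120681 / 53125) (hloQA : loQA ≤ -120681 / 53125) (hloPB : loPB ≤ -5247 / 2500) (hloQB : loQB ≤ -5247 / 2500)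
    (hhiPA : CA ≤ ((hiPA : ℚ) : ℝ)) (hhiQA : CA ≤ ((hiQA : ℚ) : ℝ)) (hhiPB : CB ≤ ((hiPB : ℚ) : ℝ)) (hhiQB : CB ≤ ((hiQB : ℚ) : ℝ))
    (pPA : -FPA - sPA₁ * (183 / 200 - 477 / 500) ≤ c ∧ -FPA - sPA₂ * (183 / 200 - 477 / 500) ≤ c ∧ -FPA ≤ c)
    (pQA : -FQA - sQA₁ * (183 / 200 - 477 / 500) ≤ c ∧ -FQA - sQA₂ * (183 / 200 - 477 / 500) ≤ c ∧ -FQA ≤ c)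
    (pPB : -FPB - sPB₁ * (183 / 200 - 477 / 500) ≤ c ∧ -FPB - sPB₂ * (183 / 200 - 477 / 500) ≤ c ∧ -FPB ≤ c)
    (pQB : -FQB - sQB₁ * (183 / 200 - 477 / 500) ≤ c ∧ -FQB - sQB₂ * (183 / 200 - 477 / 500) ≤ c ∧ -FQB ≤ c)
    (hc : c ≤ 4779578 / 10000000) :
    ∀ tp ∈ Set.Icc (-23 / 50 : ℝ) (-11 / 25), ∀ U ∈ Set.Icc (13 / 2 : ℝ) (17 / 2), ∀ n ∈ Set.Icc (9 / 10 : ℝ) (477 / 500),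
      ObsStiffnessSeqCeilingAt tp U n (4779578 / 10000000) := by
  intro tp htp U hU n hn
  rcases le_total n (183 / 200) with hlow | hhigh
  · exact ndnio2_M21_lowFillingCell183_below_bar (U := U) htp ⟨by linarith [hn.1], hlow⟩
  have hn' : n ∈ Set.Icc (183 / 200 : ℝ) (477 / 500) := ⟨hhigh, hn.2⟩
  have h6 : (0 : ℝ) ≤ 6 := by norm_num
  obtain ⟨eL, eR⟩ := ndM21_station6_highSlab_segment_ends
  obtain ⟨flA, flB⟩ := ndM21_station6_rectFloors (U := (6 : ℝ)) h6
  have x0 : (0 : ℝ) ≤ 183 / 200 := by norm_num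
  have x2 : (477 / 500 : ℝ) < 2 := by norm_num
  have wPA := bundleWindow_of_capTable h6 hcapA haA hbA hnA flA hloPA hhiPA
  have wQA := bundleWindow_of_capTable h6 hcapA haA hbA hnA flA hloQA hhiQA
  have wPB := bundleWindow_of_capTable h6 hcapB haB hbB hnB flB hloPB hhiPB
  have wQB := bundleWindow_of_capTable h6 hcapB haB hbB hnB flB hloQB hhiQB
  have fPA := orbitLowerOn_subrect_of_bundleRowWN hPA hA₁ hA₂ x0 x2 wPA n hn'
  have fQA := orbitLowerOn_subrect_of_bundleRowWN hQA hA₁ hA₂ x0 x2 wQA n hn'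
  have fPB := orbitLowerOn_subrect_of_bundleRowWN hPB hB₁ hB₂ x0 x2 wPB n hn'
  have fQB := orbitLowerOn_subrect_of_bundleRowWN hQB hB₁ hB₂ x0 x2 wQB n hn'
  have cPA := neg_wnBundleValue_le_on_R3_of_ends pPA.1 pPA.2.1 pPA.2.2 n hn'
  have cQA := neg_wnBundleValue_le_on_R3_of_ends pQA.1 pQA.2.1 pQA.2.2 n hn'
  have cPB := neg_wnBundleValue_le_on_R3_of_ends pPB.1 pPB.2.1 pPB.2.2 n hn'
  have cQB := neg_wnBundleValue_le_on_R3_of_ends pQB.1 pQB.2.1 pQB.2.2 n hn'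
  -- relabel the idle `U`-slot of the `λ = 0` objectives to the station value `6`
  have labP : -oddMomentObsTT (-23 / 50) Uo 0 = -oddMomentObsTT (-23 / 50) 6 0 := by
    rw [oddMomentObsTT_lam_zero (-23 / 50) Uo, oddMomentObsTT_lam_zero (-23 / 50) 6]
  have labQ : -oddMomentObsTT (-11 / 25) Uo 0 = -oddMomentObsTT (-11 / 25) 6 0 := by
    rw [oddMomentObsTT_lam_zero (-11 / 25) Uo, oddMomentObsTT_lam_zero (-11 / 25) 6]
  refine (ObsStiffnessSeqCeilingAt_on_highSlab_of_apexStation_twoEndObjectives (p := -23 / 50) (q := -11 / 25) (UA := (6 : ℝ))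
    (U₁ := (13 / 2 : ℝ)) (Umax := (17 / 2 : ℝ)) (n := n) (by norm_num) (by norm_num) (by norm_num) (by norm_num)
    (by linarith [hn'.1]) (by linarith [hn'.2])
    (fun s => if s ≤ -11 / 20 then wnBundleValue FPA sPA₁ sPA₂ (477 / 500) n else wnBundleValue FPB sPB₁ sPB₂ (477 / 500) n)
    (fun s => if s ≤ -11 / 20 then wnBundleValue FQA sQA₁ sQA₂ (477 / 500) n else wnBundleValue FQB sQB₁ sQB₂ (477 / 500) n)
    c ?_ ?_ ?_ tp htp U hU).mono hc
  · intro s hs ω Ls ψ hLs hψ h1 hω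
    rw [eL, eR] at hs
    rw [← labP]
    by_cases hs1 : s ≤ -11 / 20
    · simp only [if_pos hs1]; exact fPA s ⟨hs.1, hs1⟩ ω Ls ψ hLs hψ h1 hω
    · simp only [if_neg hs1]; exact fPB s ⟨(not_le.1 hs1).le, hs.2⟩ ω Ls ψ hLs hψ h1 hω
  · intro s hs ω Ls ψ hLs hψ h1 hω
    rw [eL, eR] at hs
    rw [← labQ]
    by_cases hs1 : s ≤ -11 / 20
    · simp only [if_pos hs1]; exact fQA s ⟨hs.1, hs1⟩ ω Ls ψ hLs hψ h1 hω
    · simp only [if_neg hs1]; exact fQB s ⟨(not_le.1 hs1).le, hs.2⟩ ω Ls ψ hLs hψ h1 hω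
  · intro σ hσ s _
    refine neg_slotChord_le_of_neg_le (by norm_num) hσ ?_ ?_
    · by_cases hs1 : s ≤ -11 / 20
      · simp only [if_pos hs1]; exact cPA
      · simp only [if_neg hs1]; exact cPB
    · by_cases hs1 : s ≤ -11 / 20
      · simp only [if_pos hs1]; exact cQA
      · simp only [if_neg hs1]; exact cQB

end Station6

end Summit.Ventures.CertifiedManyBodySolver.Observables

end
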